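import Summits.NavierStokesRegularity.NavierStokesRegularity.Theorems.UnthreadedDoorCellFluxDefs
import Summits.NavierStokesRegularity.NavierStokesRegularity.Theorems.ThreadingFluxHorizonTowerZonalForm
import Summits.NavierStokesRegularity.NavierStokesRegularity.Theorems.UnthreadedDoorKinematicShadowPointSourceCalculus
import Literature.Analysis.FluidPDE.FlatSwirlGauge
import HarnessLib

/-!
# Route `UnthreadedDoor`, crux `PoloidalLiouville` (stmt-NavierStokesRegularity-1222), WALL W1 — crux idea «cell-flux» (ns-idea-14):
# the cell-flux objects under a SIMILARITY of `ℝ³`, and Σ-0e `ClusterFluxTimeLipschitz` FROM Σ-0b′ by parabolic rescaling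

Support file (theorems only; `--supports stmt-NavierStokesRegularity-1222 --as helper`).  (1) Bookkeeping: how the objects of the
Defs twin `UnthreadedDoorCellFluxDefs` transform under the similarity `ψ y = x₀ + μ • y` (`μ > 0`) and the rescaling
`f ↦ (y ↦ c · f (ψ y))` (`c > 0`): `sphCrit`/`sheetTrace`/`cellOf`/`cellSet` are pulled back by `ψ` (accumulation points and connected
components are topological: `Homeomorph.image_connectedComponentIn`), `setOsc (c·f∘ψ) (ψ ⁻¹' K) = c · setOsc f K`
(`Real.sSup_smul_of_nonneg`), `clusterFlux (c·f∘ψ) r ((ψ ⁻¹' ·) '' 𝒦) = (c/μ) · clusterFlux f (μ r) 𝒦`; cluster partitions,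
head-coherence (same constant, `G ↦ c·G(·/c)`) and ADMISSIBLE RULES are transported (`AdmissibleRule x₀ T P V t₀ 𝒞 →
AdmissibleRule 0 T̃ P̃ Ṽ (t₀/μ²) 𝒞̃` for `T̃ t y = μ² T(μ² t)(ψ y)`, `Ṽ t = μ V(μ² t)`, `𝒞̃ t r = (ψ ⁻¹' ·) '' 𝒞 (μ² t) (μ r)`), and so
are window smoothness, the link `curl v = ∇T × (x − x₀)` and the dense cell-count set.  (2) ★ `clusterFlux_timeLipschitz_of_nearCentreLinked`:
the `t`-Lipschitz control of the cluster flux at ALL radii (Σ-0e, ns-qj-p1 g8's missing AE-3 analogue for Σ-3′) follows from the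
near-centre statement Σ-0b′ `ClusterFluxNearCentreLinked` (radii `< 1`) applied to the rescaled data with `μ = R`.
Nothing here is about Navier–Stokes; ⟨1222⟩, W1 and NS regularity stay OPEN.  ARM A `pub/ns-exp-scalarLiouville` g8.
-/

noncomputable section

-- the summit and its single sub-problem share the name (CONVENTIONS §1)
set_option linter.dupNamespace false

open Set Function Filter Topology MeasureTheory
open scoped RealInnerProductSpace Pointwise

namespace Summit.NavierStokesRegularity.NavierStokesRegularity.Theorems.PoloidalLiouville.CellFlux

open Summit.NavierStokesRegularity.NavierStokesRegularity.Theorems.PoloidalLiouville.NetFlux (E3)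
open Literature.Analysis Literature.Analysis.FluidPDE

variable {x₀ : E3} {μ c : ℝ} {ψ : E3 ≃ₜ E3}

/-- The similarity `y ↦ x₀ + μ • y` (`μ ≠ 0`) as a homeomorphism of `ℝ³`. [folklore] -/
theorem exists_homeomorph_simil (x₀ : E3) {μ : ℝ} (hμ : μ ≠ 0) :
    ∃ ψ : E3 ≃ₜ E3, ∀ y, ψ y = x₀ + μ • y :=
  ⟨(Homeomorph.smulOfNeZero μ hμ).trans (Homeomorph.addLeft x₀), fun _ => rfl⟩

/-- `ψ y − x₀ = μ • y`. [folklore] -/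
theorem simil_sub_centre (hψ : ∀ y, ψ y = x₀ + μ • y) (y : E3) : ψ y - x₀ = μ • y := by
  rw [hψ]; abel

/-- `ψ y` lies on `S_{μ r}(x₀)` iff `y` lies on `S_r(0)` (`μ > 0`). [folklore] -/
theorem simil_mem_sphere_iff (hψ : ∀ y, ψ y = x₀ + μ • y) (hμ : 0 < μ) {r : ℝ} {y : E3} :
    ψ y ∈ Metric.sphere x₀ (μ * r) ↔ y ∈ Metric.sphere (0 : E3) r := by
  rw [mem_sphere_iff_norm, mem_sphere_iff_norm, simil_sub_centre hψ, sub_zero, norm_smul,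
    Real.norm_of_nonneg hμ.le]
  exact ⟨fun h => mul_left_cancel₀ hμ.ne' h, fun h => by rw [h]⟩

/-- **Gradient of a rescaled scalar**: `∇(c · f ∘ ψ)(y) = (c μ) • (∇f)(ψ y)`, no differentiability hypothesis. [folklore] -/
theorem gradient_rescale (hψ : ∀ y, ψ y = x₀ + μ • y) (c : ℝ) (f : E3 → ℝ) (y : E3) :
    gradient (fun y => c * f (ψ y)) y = (c * μ) • gradient f (ψ y) := by
  have hfun : (fun y => c * f (ψ y)) = c • ((fun z => f (x₀ + z)) ∘ fun y : E3 => μ • y) := by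
    funext z; simp [hψ, smul_eq_mul]
  unfold gradient
  rw [hfun, fderiv_const_smul_field, Pi.smul_apply]
  have h2 : fderiv ℝ ((fun z => f (x₀ + z)) ∘ fun y : E3 => μ • y) y = μ • fderiv ℝ f (x₀ + μ • y) := by
    have := fderiv_comp_smul (𝕜 := ℝ) (f := fun z => f (x₀ + z)) (x := y) μ
    simp only [fderiv_comp_add_left] at this
    exact this
  rw [h2, smul_smul, map_smul, hψ]

/-- **Sphere-critical sets are transported**: `sphCrit (c·f∘ψ) 0 r = ψ ⁻¹' sphCrit f x₀ (μ r)` (`μ > 0`, `c ≠ 0`). [folklore] -/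
theorem sphCrit_rescale (hψ : ∀ y, ψ y = x₀ + μ • y) (hμ : 0 < μ) (hc : c ≠ 0) (f : E3 → ℝ) (r : ℝ) :
    sphCrit (fun y => c * f (ψ y)) 0 r = ψ ⁻¹' sphCrit f x₀ (μ * r) := by
  ext y
  simp only [sphCrit, mem_setOf_eq, mem_preimage]
  rw [gradient_rescale hψ, sub_zero, simil_sub_centre hψ, HorizonTower.cross_smul_left,
    KinematicShadow.PointSource.cross_smul_right,
    simil_mem_sphere_iff hψ hμ, smul_eq_zero, smul_eq_zero]
  constructor
  · rintro ⟨h1, h2⟩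
    refine ⟨h1, Or.inr (h2.resolve_left (mul_ne_zero hc hμ.ne'))⟩
  · rintro ⟨h1, h2⟩
    exact ⟨h1, Or.inr (h2.resolve_left hμ.ne')⟩

/-- Accumulation points are transported by homeomorphisms: `y` accumulates on `ψ ⁻¹' S` iff `ψ y` accumulates on `S`. [folklore] -/
theorem accPt_principal_preimage_iff (ψ : E3 ≃ₜ E3) (S : Set E3) (y : E3) :
    AccPt y (𝓟 (ψ ⁻¹' S)) ↔ AccPt (ψ y) (𝓟 S) := by
  rw [accPt_principal_iff_clusterPt, accPt_principal_iff_clusterPt, ← mem_closure_iff_clusterPt,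
    ← mem_closure_iff_clusterPt]
  have : ψ ⁻¹' S \ {y} = ψ ⁻¹' (S \ {ψ y}) := by
    ext z
    simp only [Set.mem_sdiff, mem_preimage, mem_singleton_iff, ψ.injective.eq_iff]
  rw [this, ← ψ.preimage_closure, mem_preimage]

/-- **Sheet traces are transported**: `sheetTrace (c·f∘ψ) 0 r = ψ ⁻¹' sheetTrace f x₀ (μ r)`. [folklore] -/
theorem sheetTrace_rescale (hψ : ∀ y, ψ y = x₀ + μ • y) (hμ : 0 < μ) (hc : c ≠ 0) (f : E3 → ℝ) (r : ℝ) :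
    sheetTrace (fun y => c * f (ψ y)) 0 r = ψ ⁻¹' sheetTrace f x₀ (μ * r) := by
  ext y
  simp only [sheetTrace, mem_setOf_eq, mem_preimage, sphCrit_rescale hψ hμ hc, accPt_principal_preimage_iff]

/-- The complement of the sheet traces in the sphere is transported. [folklore] -/
theorem sphere_diff_sheetTrace_rescale (hψ : ∀ y, ψ y = x₀ + μ • y) (hμ : 0 < μ) (hc : c ≠ 0) (f : E3 → ℝ)
    (r : ℝ) :
    Metric.sphere (0 : E3) r \ sheetTrace (fun y => c * f (ψ y)) 0 r =
      ψ ⁻¹' (Metric.sphere x₀ (μ * r) \ sheetTrace f x₀ (μ * r)) := by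
  ext y
  simp only [Set.mem_sdiff, mem_preimage, sheetTrace_rescale hψ hμ hc, simil_mem_sphere_iff hψ hμ]

/-- **Cells are transported**: `cellOf (c·f∘ψ) 0 r y = ψ ⁻¹' cellOf f x₀ (μ r) (ψ y)`. [folklore] -/
theorem cellOf_rescale (hψ : ∀ y, ψ y = x₀ + μ • y) (hμ : 0 < μ) (hc : c ≠ 0) (f : E3 → ℝ) (r : ℝ)
    (y : E3) :
    cellOf (fun y => c * f (ψ y)) 0 r y = ψ ⁻¹' cellOf f x₀ (μ * r) (ψ y) := by
  unfold cellOf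
  rw [sphere_diff_sheetTrace_rescale hψ hμ hc]
  set A : Set E3 := Metric.sphere x₀ (μ * r) \ sheetTrace f x₀ (μ * r)
  by_cases hy : y ∈ ψ ⁻¹' A
  · have h := ψ.image_connectedComponentIn (s := ψ ⁻¹' A) hy
    rw [ψ.image_preimage] at h
    rw [← h, ψ.preimage_image]
  · have hy' : ψ y ∉ A := hy
    rw [connectedComponentIn_eq_empty hy, connectedComponentIn_eq_empty hy', preimage_empty]

/-- **Cell sets are transported**: `cellSet (c·f∘ψ) 0 r = (ψ ⁻¹' ·) '' cellSet f x₀ (μ r)`. [folklore] -/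
theorem cellSet_rescale (hψ : ∀ y, ψ y = x₀ + μ • y) (hμ : 0 < μ) (hc : c ≠ 0) (f : E3 → ℝ) (r : ℝ) :
    cellSet (fun y => c * f (ψ y)) 0 r = (fun K => ψ ⁻¹' K) '' cellSet f x₀ (μ * r) := by
  unfold cellSet
  rw [sphere_diff_sheetTrace_rescale hψ hμ hc, ← ψ.image_symm, image_image, image_image]
  refine image_congr fun x _ => ?_
  rw [cellOf_rescale hψ hμ hc, ψ.apply_symm_apply, ψ.image_symm]

/-- The image of a preimage class under the rescaled scalar is the dilate of the image of the class. [folklore] -/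
theorem image_rescale_preimage (f : E3 → ℝ) (c : ℝ) (K : Set E3) :
    (fun y => c * f (ψ y)) '' (ψ ⁻¹' K) = c • (f '' K) := by
  ext z
  simp only [mem_image, mem_preimage, mem_smul_set, smul_eq_mul]
  constructor
  · rintro ⟨y, hy, rfl⟩
    exact ⟨f (ψ y), ⟨ψ y, hy, rfl⟩, rfl⟩
  · rintro ⟨w, ⟨x, hx, rfl⟩, rfl⟩
    exact ⟨ψ.symm x, by rwa [ψ.apply_symm_apply], by rw [ψ.apply_symm_apply]⟩

/-- **Oscillations scale**: `setOsc (c·f∘ψ) (ψ ⁻¹' K) = c · setOsc f K` for `c ≥ 0` (no boundedness needed). [folklore] -/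
theorem setOsc_rescale (hc : 0 ≤ c) (f : E3 → ℝ) (K : Set E3) :
    setOsc (fun y => c * f (ψ y)) (ψ ⁻¹' K) = c * setOsc f K := by
  unfold setOsc
  rw [image_rescale_preimage, Real.sSup_smul_of_nonneg hc, Real.sInf_smul_of_nonneg hc, smul_eq_mul,
    smul_eq_mul, mul_sub]

/-- **Cluster fluxes scale**: `clusterFlux (c·f∘ψ) r ((ψ ⁻¹' ·) '' 𝒦) = (c r) · Σ_{K ∈ 𝒦} osc_K f` for `c ≥ 0`. [folklore] -/
theorem clusterFlux_rescale (hc : 0 ≤ c) (f : E3 → ℝ) (r : ℝ) (𝒦 : Set (Set E3)) :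
    clusterFlux (fun y => c * f (ψ y)) r ((fun K => ψ ⁻¹' K) '' 𝒦) = (c * r) * ∑ᶠ K ∈ 𝒦, setOsc f K := by
  unfold clusterFlux
  rw [finsum_mem_image ψ.surjective.preimage_injective.injOn]
  simp only [setOsc_rescale hc]
  rw [← mul_finsum_mem, mul_assoc, mul_left_comm]

/-- **Cluster fluxes scale** (radius form): `clusterFlux (c·f∘ψ) r ((ψ ⁻¹' ·) '' 𝒦) = (c/μ) · clusterFlux f (μ r) 𝒦`. [folklore] -/
theorem clusterFlux_rescale' (hμ : μ ≠ 0) (hc : 0 ≤ c) (f : E3 → ℝ) (r : ℝ) (𝒦 : Set (Set E3)) :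
    clusterFlux (fun y => c * f (ψ y)) r ((fun K => ψ ⁻¹' K) '' 𝒦) = (c / μ) * clusterFlux f (μ * r) 𝒦 := by
  rw [clusterFlux_rescale hc]
  unfold clusterFlux
  field_simp

/-- Finiteness of the transported family. [folklore] -/
theorem finite_image_preimage_simil_iff (ψ : E3 ≃ₜ E3) (𝒦 : Set (Set E3)) :
    ((fun K : Set E3 => ψ ⁻¹' K) '' 𝒦).Finite ↔ 𝒦.Finite :=
  finite_image_iff ψ.surjective.preimage_injective.injOn

/-- Cardinality of the transported family. [folklore] -/
theorem ncard_image_preimage_simil (ψ : E3 ≃ₜ E3) (𝒦 : Set (Set E3)) :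
    ((fun K : Set E3 => ψ ⁻¹' K) '' 𝒦).ncard = 𝒦.ncard :=
  ncard_image_of_injective 𝒦 ψ.surjective.preimage_injective

/-- **Cluster partitions are transported.** [folklore] -/
theorem isClusterPartition_rescale (hψ : ∀ y, ψ y = x₀ + μ • y) (hμ : 0 < μ) (hc : c ≠ 0) {f : E3 → ℝ} {r : ℝ}
    {𝒦 : Set (Set E3)} (h : IsClusterPartition f x₀ (μ * r) 𝒦) :
    IsClusterPartition (fun y => c * f (ψ y)) 0 r ((fun K => ψ ⁻¹' K) '' 𝒦) := by
  obtain ⟨hfin, hcls, hcov, hdisj⟩ := h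
  refine ⟨hfin.image _, ?_, ?_, ?_⟩
  · rintro K' ⟨K, hK, rfl⟩
    obtain ⟨hne, 𝒪, h𝒪, hK𝒪⟩ := hcls K hK
    refine ⟨?_, (fun O => ψ ⁻¹' O) '' 𝒪, ?_, ?_⟩
    · obtain ⟨x, hx⟩ := hne
      exact ⟨ψ.symm x, by show ψ (ψ.symm x) ∈ K; rwa [ψ.apply_symm_apply]⟩
    · rw [cellSet_rescale hψ hμ hc]; exact image_mono h𝒪
    · rw [hK𝒪]
      show ψ ⁻¹' ⋃₀ 𝒪 = ⋃₀ ((fun O => ψ ⁻¹' O) '' 𝒪)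
      rw [preimage_sUnion, sUnion_image]
  · rw [sUnion_image, sphere_diff_sheetTrace_rescale hψ hμ hc, ← hcov, preimage_sUnion]
  · rintro K₁' ⟨K₁, hK₁, rfl⟩ K₂' ⟨K₂, hK₂, rfl⟩ hne
    have hne' : K₁ ≠ K₂ := fun h => hne (by rw [h])
    exact (hdisj hK₁ hK₂ hne').preimage ψ

/-- **Head-coherence is transported** with the same constant: `G ↦ c · G(·/c)` (`c > 0`). [folklore] -/
theorem headCoherent_rescale (hc : 0 < c) {f g : E3 → ℝ} {L : ℝ} {K : Set E3} (h : HeadCoherent f g L K) :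
    HeadCoherent (fun y => c * f (ψ y)) (fun y => c * g (ψ y)) L (ψ ⁻¹' K) := by
  obtain ⟨G, hG, hfg⟩ := h
  refine ⟨fun z => c * G (c⁻¹ * z), ?_, fun y hy => ?_⟩
  · refine LipschitzWith.of_dist_le_mul fun z z' => ?_
    have h1 := hG.dist_le_mul (c⁻¹ * z) (c⁻¹ * z')
    simp only [Real.dist_eq] at h1 ⊢
    rw [← mul_sub, abs_mul, abs_of_pos (inv_pos.2 hc)] at h1
    rw [← mul_sub, abs_mul, abs_of_pos hc]
    calc c * |G (c⁻¹ * z) - G (c⁻¹ * z')| ≤ c * (↑(Real.toNNReal L) * (c⁻¹ * |z - z'|)) :=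
          mul_le_mul_of_nonneg_left h1 hc.le
      _ = ↑(Real.toNNReal L) * |z - z'| := by field_simp
  · have hy' : ψ y ∈ closure K := by
      rw [← ψ.preimage_closure] at hy
      exact hy
    show c * g (ψ y) = c * G (c⁻¹ * (c * f (ψ y)))
    rw [hfg _ hy', ← mul_assoc, inv_mul_cancel₀ hc.ne', one_mul]

/-- Time rescaling: `t ∈ (t₀/μ², 0)` iff `μ² t ∈ (t₀, 0)`. [folklore] -/
theorem mem_Ioo_rescale_time (hμ : 0 < μ) {t₀ t : ℝ} : t ∈ Ioo (t₀ / μ ^ 2) 0 ↔ μ ^ 2 * t ∈ Ioo t₀ 0 := by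
  have hμ2 : 0 < μ ^ 2 := by positivity
  rw [mem_Ioo, mem_Ioo, div_lt_iff₀ hμ2, mul_comm]
  exact ⟨fun ⟨h1, h2⟩ => ⟨h1, by nlinarith⟩, fun ⟨h1, h2⟩ => ⟨h1, by nlinarith⟩⟩

/-- **Admissible rules are transported** by the parabolic rescaling (window `(t₀/μ², 0)`, centre `0`). [folklore] -/
theorem admissibleRule_rescale (hψ : ∀ y, ψ y = x₀ + μ • y) (hμ : 0 < μ) {T P : ℝ → E3 → ℝ} {V : ℝ → ℝ} {t₀ : ℝ}
    {𝒞 : ℝ → ℝ → Set (Set E3)} (h : AdmissibleRule x₀ T P V t₀ 𝒞) :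
    AdmissibleRule 0 (fun t y => μ ^ 2 * T (μ ^ 2 * t) (ψ y)) (fun t y => μ ^ 2 * P (μ ^ 2 * t) (ψ y))
      (fun t => μ * V (μ ^ 2 * t)) (t₀ / μ ^ 2) (fun t r => (fun K => ψ ⁻¹' K) '' 𝒞 (μ ^ 2 * t) (μ * r)) := by
  have hμ2 : 0 < μ ^ 2 := by positivity
  obtain ⟨hpart, hcoh, hcont, hcnt⟩ := h
  refine ⟨fun t ht r hr => ?_, fun t ht r hr K' hK' => ?_, ?_, fun t ht r hr hfin => ?_⟩
  · exact isClusterPartition_rescale hψ hμ hμ2.ne' (hpart _ ((mem_Ioo_rescale_time hμ).1 ht) _ (mul_pos hμ hr))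
  · obtain ⟨K, hK, rfl⟩ := hK'
    have h2 := headCoherent_rescale (ψ := ψ) hμ2 (hcoh _ ((mem_Ioo_rescale_time hμ).1 ht) _ (mul_pos hμ hr) K hK)
    have h3 : μ * r * V (μ ^ 2 * t) = r * (μ * V (μ ^ 2 * t)) := by ring
    rw [h3] at h2
    exact h2
  · have hfun : (fun p : ℝ × ℝ => clusterFlux ((fun t y => μ ^ 2 * T (μ ^ 2 * t) (ψ y)) p.1) p.2
        ((fun t r => (fun K => ψ ⁻¹' K) '' 𝒞 (μ ^ 2 * t) (μ * r)) p.1 p.2)) =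
        fun p : ℝ × ℝ => μ * ((fun q : ℝ × ℝ => clusterFlux (T q.1) q.2 (𝒞 q.1 q.2)) (μ ^ 2 * p.1, μ * p.2)) := by
      funext p
      simp only
      rw [clusterFlux_rescale' hμ.ne' hμ2.le, pow_two, mul_div_assoc, div_self hμ.ne', mul_one]
    rw [hfun]
    refine continuousOn_const.mul (hcont.comp (by fun_prop) fun p hp => ?_)
    exact ⟨(mem_Ioo_rescale_time hμ).1 hp.1, mul_pos hμ hp.2⟩
  · simp only at hfin ⊢
    rw [cellSet_rescale hψ hμ hμ2.ne', finite_image_preimage_simil_iff] at hfin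
    rw [cellSet_rescale hψ hμ hμ2.ne', ncard_image_preimage_simil, ncard_image_preimage_simil]
    exact hcnt _ ((mem_Ioo_rescale_time hμ).1 ht) _ (mul_pos hμ hr) hfin

/-- Window smoothness of the rescaled velocity `ṽ t y = μ v(μ² t)(ψ y)`. [folklore] -/
theorem contDiffOn_rescale_velocity (hψ : ∀ y, ψ y = x₀ + μ • y) (hμ : 0 < μ) {v : ℝ → E3 → E3} {t₀ : ℝ}
    (hv : ContDiffOn ℝ (⊤ : ℕ∞) (uncurry v) (Ioo t₀ 0 ×ˢ (univ : Set E3))) :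
    ContDiffOn ℝ (⊤ : ℕ∞) (uncurry fun t y => μ • v (μ ^ 2 * t) (ψ y)) (Ioo (t₀ / μ ^ 2) 0 ×ˢ (univ : Set E3)) := by
  have hΦ : ContDiff ℝ (⊤ : ℕ∞) (fun p : ℝ × E3 => ((μ ^ 2 * p.1, x₀ + μ • p.2) : ℝ × E3)) := by fun_prop
  have hmaps : MapsTo (fun p : ℝ × E3 => ((μ ^ 2 * p.1, x₀ + μ • p.2) : ℝ × E3))
      (Ioo (t₀ / μ ^ 2) 0 ×ˢ (univ : Set E3)) (Ioo t₀ 0 ×ˢ (univ : Set E3)) :=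
    fun p hp => ⟨(mem_Ioo_rescale_time hμ).1 hp.1, mem_univ _⟩
  have h := (hv.comp hΦ.contDiffOn hmaps).const_smul μ
  have hfun : (uncurry fun t y => μ • v (μ ^ 2 * t) (ψ y)) =
      fun p : ℝ × E3 => μ • (uncurry v ∘ fun p : ℝ × E3 => ((μ ^ 2 * p.1, x₀ + μ • p.2) : ℝ × E3)) p := by
    funext p; simp only [uncurry, comp_apply, hψ]
  rw [hfun]; exact h

/-- Window smoothness off the centre of a rescaled scalar `T̃ t y = μ² T(μ² t)(ψ y)`. [folklore] -/
theorem contDiffOn_rescale_scalar (hψ : ∀ y, ψ y = x₀ + μ • y) (hμ : 0 < μ) {T : ℝ → E3 → ℝ} {t₀ : ℝ}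
    (hT : ContDiffOn ℝ (⊤ : ℕ∞) (uncurry T) (Ioo t₀ 0 ×ˢ ({x₀}ᶜ : Set E3))) :
    ContDiffOn ℝ (⊤ : ℕ∞) (uncurry fun t y => μ ^ 2 * T (μ ^ 2 * t) (ψ y))
      (Ioo (t₀ / μ ^ 2) 0 ×ˢ ({0}ᶜ : Set E3)) := by
  have hΦ : ContDiff ℝ (⊤ : ℕ∞) (fun p : ℝ × E3 => ((μ ^ 2 * p.1, x₀ + μ • p.2) : ℝ × E3)) := by fun_prop
  have hmaps : MapsTo (fun p : ℝ × E3 => ((μ ^ 2 * p.1, x₀ + μ • p.2) : ℝ × E3))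
      (Ioo (t₀ / μ ^ 2) 0 ×ˢ ({0}ᶜ : Set E3)) (Ioo t₀ 0 ×ˢ ({x₀}ᶜ : Set E3)) := by
    intro p hp
    refine ⟨(mem_Ioo_rescale_time hμ).1 hp.1, ?_⟩
    have h0 : p.2 ≠ 0 := hp.2
    show x₀ + μ • p.2 ∈ ({x₀}ᶜ : Set E3)
    rw [mem_compl_singleton_iff, ne_eq, add_eq_left, smul_eq_zero, not_or]
    exact ⟨hμ.ne', h0⟩
  have h := (hT.comp hΦ.contDiffOn hmaps).const_smul (μ ^ 2)
  have hfun : (uncurry fun t y => μ ^ 2 * T (μ ^ 2 * t) (ψ y)) =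
      fun p : ℝ × E3 => μ ^ 2 • (uncurry T ∘ fun p : ℝ × E3 => ((μ ^ 2 * p.1, x₀ + μ • p.2) : ℝ × E3)) p := by
    funext p; simp only [uncurry, comp_apply, hψ, smul_eq_mul]
  rw [hfun]; exact h

/-- **The link `curl v = ∇T × (x − x₀)` is transported** to `curl ṽ = ∇T̃ × y` (no differentiability hypothesis). [folklore] -/
theorem link_rescale (hψ : ∀ y, ψ y = x₀ + μ • y) {v : ℝ → E3 → E3} {T : ℝ → E3 → ℝ} {t₀ : ℝ} (hμ : 0 < μ)
    (hlink : ∀ t ∈ Ioo t₀ 0, ∀ x, curl (v t) x = cross (gradient (T t) x) (x - x₀)) :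
    ∀ t ∈ Ioo (t₀ / μ ^ 2) 0, ∀ y, curl ((fun t y => μ • v (μ ^ 2 * t) (ψ y)) t) y =
      cross (gradient ((fun t y => μ ^ 2 * T (μ ^ 2 * t) (ψ y)) t) y) (y - 0) := by
  intro t ht y
  have hs := (mem_Ioo_rescale_time hμ).1 ht
  simp only [sub_zero]
  rw [gradient_rescale hψ, HorizonTower.cross_smul_left]
  have hψ' : ψ y = μ • y + x₀ := by rw [hψ, add_comm]
  have hcurl : curl (fun y => μ • v (μ ^ 2 * t) (ψ y)) y = (μ * μ) • curl (v (μ ^ 2 * t)) (ψ y) := by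
    have h1 := curl_smul_comp_smul (fun z => v (μ ^ 2 * t) (z + x₀)) μ μ y
    have h2 := curl_comp_add_const (v (μ ^ 2 * t)) x₀ (μ • y)
    beta_reduce at h1
    rw [h2] at h1
    have hfun : (fun y => μ • v (μ ^ 2 * t) (ψ y)) = fun y => μ • v (μ ^ 2 * t) (μ • y + x₀) := by
      funext z; rw [hψ, add_comm]
    rw [hfun, h1, ← hψ']
  rw [hcurl, hlink _ hs, simil_sub_centre hψ, KinematicShadow.PointSource.cross_smul_right, smul_smul]
  congr 1; ring

/-- **The dense cell-count set is transported** (the time/radius rescaling is a homeomorphism of `ℝ²`; `cellSet_rescale`). [folklore] -/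
theorem dense_count_rescale (hψ : ∀ y, ψ y = x₀ + μ • y) (hμ : 0 < μ) {T : ℝ → E3 → ℝ} {t₀ t₁ t₂ : ℝ} {N₀ : ℕ}
    (hdense : Icc t₁ t₂ ×ˢ Ioi (0 : ℝ) ⊆ closure {p : ℝ × ℝ | p.1 ∈ Ioo t₀ 0 ∧ 0 < p.2 ∧
        (cellSet (T p.1) x₀ p.2).Finite ∧ (cellSet (T p.1) x₀ p.2).ncard ≤ N₀}) :
    Icc (t₁ / μ ^ 2) (t₂ / μ ^ 2) ×ˢ Ioo (0 : ℝ) 1 ⊆ closure {p : ℝ × ℝ | p.1 ∈ Ioo (t₀ / μ ^ 2) 0 ∧ 0 < p.2 ∧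
        (cellSet ((fun t y => μ ^ 2 * T (μ ^ 2 * t) (ψ y)) p.1) 0 p.2).Finite ∧
        (cellSet ((fun t y => μ ^ 2 * T (μ ^ 2 * t) (ψ y)) p.1) 0 p.2).ncard ≤ N₀} := by
  have hμ2 : 0 < μ ^ 2 := by positivity
  set Θ : ℝ × ℝ ≃ₜ ℝ × ℝ :=
    (Homeomorph.smulOfNeZero (μ ^ 2) hμ2.ne').prodCongr (Homeomorph.smulOfNeZero μ hμ.ne') with hΘ
  have hΘap : ∀ p : ℝ × ℝ, Θ p = (μ ^ 2 * p.1, μ * p.2) := fun p => by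
    simp [hΘ, Homeomorph.coe_prodCongr, Prod.map, smul_eq_mul]
  -- the rescaled counted set is the preimage of the original one under `Θ`
  have hset : {p : ℝ × ℝ | p.1 ∈ Ioo (t₀ / μ ^ 2) 0 ∧ 0 < p.2 ∧
        (cellSet ((fun t y => μ ^ 2 * T (μ ^ 2 * t) (ψ y)) p.1) 0 p.2).Finite ∧
        (cellSet ((fun t y => μ ^ 2 * T (μ ^ 2 * t) (ψ y)) p.1) 0 p.2).ncard ≤ N₀} =
      Θ ⁻¹' {p : ℝ × ℝ | p.1 ∈ Ioo t₀ 0 ∧ 0 < p.2 ∧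
        (cellSet (T p.1) x₀ p.2).Finite ∧ (cellSet (T p.1) x₀ p.2).ncard ≤ N₀} := by
    ext p
    simp only [mem_setOf_eq, mem_preimage, hΘap, cellSet_rescale hψ hμ hμ2.ne', finite_image_preimage_simil_iff,
      ncard_image_preimage_simil, mem_Ioo_rescale_time hμ, mul_pos_iff_of_pos_left hμ]
  rw [hset, ← Θ.preimage_closure]
  intro p hp
  refine hdense ⟨⟨?_, ?_⟩, ?_⟩
  · have := hp.1.1; rw [hΘap]; rw [div_le_iff₀ hμ2] at this; linarith
  · have := hp.1.2; rw [hΘap]; rw [le_div_iff₀ hμ2] at this; linarith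
  · rw [hΘap]; exact mul_pos hμ hp.2.1

/-- ★ **Σ-0e `ClusterFluxTimeLipschitz` FROM Σ-0b′ `ClusterFluxNearCentreLinked` by PARABOLIC RESCALING** (hypothesis `hNC` = the body
of Σ-0b′ of `Cruxes/PoloidalLiouville/CellFluxSketch.lean` v1.2.12 VERBATIM; conclusion = the body of Σ-0e as re-typed by ns-qj-p1 g8,
2026-08-29T14:31Z: same binder block with the counted set dense on `[t₁,t₂] × (0,∞)`, `t`-Lipschitz control of the cluster flux of an
admissible rule on `[t₁,t₂]` uniformly at ALL radii `a < R`).  Proof: `hNC` (iii) with `a₀ = 1` for the rescaled data `ṽ t y = R v(R² t)(ψ y)`,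
`T̃ t y = R² T(R² t)(ψ y)`, `P̃`, `Ṽ t = R V(R² t)`, window `(t₀/R², 0)`, centre `0`, rule `𝒞̃ t a = (ψ ⁻¹' ·) '' 𝒞 (R² t) (R a)`
(`admissibleRule_rescale`), whose flux is `R · F(R² t, R a)` (`clusterFlux_rescale'`): `L = κ̃/R³`.  So Σ-0e closes by name with Σ-0b′
(= Σ-0bR₁, landed p718757, + Σ-0bR₂, OPEN) and is not an independent stub. [folklore] -/
theorem clusterFlux_timeLipschitz_of_nearCentreLinked
    (hNC : ∀ (v : ℝ → E3 → E3) (x₀ : E3) (T P : ℝ → E3 → ℝ) (V : ℝ → ℝ) (N₀ : ℕ) (t₀ t₁ t₂ : ℝ),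
      t₀ < t₁ → t₁ ≤ t₂ → t₂ < 0 →
      ContDiffOn ℝ (⊤ : ℕ∞) (uncurry v) (Ioo t₀ 0 ×ˢ (univ : Set E3)) →
      ContDiffOn ℝ (⊤ : ℕ∞) (uncurry T) (Ioo t₀ 0 ×ˢ ({x₀}ᶜ : Set E3)) →
      (∀ t ∈ Ioo t₀ 0, ∀ x, curl (v t) x = cross (gradient (T t) x) (x - x₀)) →
      Icc t₁ t₂ ×ˢ Ioo (0 : ℝ) 1 ⊆ closure {p : ℝ × ℝ | p.1 ∈ Ioo t₀ 0 ∧ 0 < p.2 ∧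
          (cellSet (T p.1) x₀ p.2).Finite ∧ (cellSet (T p.1) x₀ p.2).ncard ≤ N₀} →
      ∀ 𝒞 : ℝ → ℝ → Set (Set E3), AdmissibleRule x₀ T P V t₀ 𝒞 →
      ∃ κ : ℝ, 0 ≤ κ ∧ ∀ a₀ : ℝ, 0 < a₀ → a₀ ≤ 1 →
        (∀ t ∈ Icc t₁ t₂,
          (∀ a ∈ Ioo 0 a₀, clusterFlux (T t) a (𝒞 t a) ≤ κ * a ^ 2) ∧
          LipschitzOnWith (Real.toNNReal (κ * a₀)) (fun r => clusterFlux (T t) r (𝒞 t r)) (Ioo 0 a₀)) ∧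
        (∀ t ∈ Icc t₁ t₂, ∀ t' ∈ Icc t₁ t₂, ∀ a ∈ Ioo 0 a₀,
          |clusterFlux (T t) a (𝒞 t a) - clusterFlux (T t') a (𝒞 t' a)| ≤ κ * a ^ 2 * |t - t'|))
    (v : ℝ → E3 → E3) (x₀ : E3) (T P : ℝ → E3 → ℝ) (V : ℝ → ℝ) (N₀ : ℕ) (t₀ t₁ t₂ : ℝ)
    (h01 : t₀ < t₁) (h12 : t₁ ≤ t₂) (h20 : t₂ < 0)
    (hv : ContDiffOn ℝ (⊤ : ℕ∞) (uncurry v) (Ioo t₀ 0 ×ˢ (univ : Set E3)))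
    (hT : ContDiffOn ℝ (⊤ : ℕ∞) (uncurry T) (Ioo t₀ 0 ×ˢ ({x₀}ᶜ : Set E3)))
    (hlink : ∀ t ∈ Ioo t₀ 0, ∀ x, curl (v t) x = cross (gradient (T t) x) (x - x₀))
    (hdense : Icc t₁ t₂ ×ˢ Ioi (0 : ℝ) ⊆ closure {p : ℝ × ℝ | p.1 ∈ Ioo t₀ 0 ∧ 0 < p.2 ∧
        (cellSet (T p.1) x₀ p.2).Finite ∧ (cellSet (T p.1) x₀ p.2).ncard ≤ N₀})
    (𝒞 : ℝ → ℝ → Set (Set E3)) (h𝒞 : AdmissibleRule x₀ T P V t₀ 𝒞) :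
    ∀ R : ℝ, 0 < R → ∃ L : ℝ, 0 ≤ L ∧ ∀ t ∈ Icc t₁ t₂, ∀ t' ∈ Icc t₁ t₂, ∀ a ∈ Ioo 0 R,
      |clusterFlux (T t) a (𝒞 t a) - clusterFlux (T t') a (𝒞 t' a)| ≤ L * |t - t'| := by
  intro R hR
  have hR2 : 0 < R ^ 2 := by positivity
  obtain ⟨ψ, hψ⟩ := exists_homeomorph_simil x₀ hR.ne'
  obtain ⟨κ, hκ, H⟩ := hNC (fun t y => R • v (R ^ 2 * t) (ψ y)) 0 (fun t y => R ^ 2 * T (R ^ 2 * t) (ψ y))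
    (fun t y => R ^ 2 * P (R ^ 2 * t) (ψ y)) (fun t => R * V (R ^ 2 * t)) N₀ (t₀ / R ^ 2) (t₁ / R ^ 2) (t₂ / R ^ 2)
    (div_lt_div_of_pos_right h01 hR2) (div_le_div_of_nonneg_right h12 hR2.le) (div_neg_of_neg_of_pos h20 hR2)
    (contDiffOn_rescale_velocity hψ hR hv) (contDiffOn_rescale_scalar hψ hR hT) (link_rescale hψ hR hlink)
    (dense_count_rescale hψ hR hdense) _ (admissibleRule_rescale hψ hR h𝒞)
  obtain ⟨-, H3⟩ := H 1 one_pos le_rfl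
  refine ⟨κ / R ^ 3, by positivity, fun t ht t' ht' a ha => ?_⟩
  have hsc : ∀ s ∈ Icc t₁ t₂, s / R ^ 2 ∈ Icc (t₁ / R ^ 2) (t₂ / R ^ 2) := fun s hs =>
    ⟨div_le_div_of_nonneg_right hs.1 hR2.le, div_le_div_of_nonneg_right hs.2 hR2.le⟩
  have ha' : a / R ∈ Ioo (0 : ℝ) 1 := ⟨div_pos ha.1 hR, (div_lt_one hR).2 ha.2⟩
  have key := H3 _ (hsc t ht) _ (hsc t' ht') _ ha'
  have e1 : R ^ 2 * (t / R ^ 2) = t := by field_simp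
  have e1' : R ^ 2 * (t' / R ^ 2) = t' := by field_simp
  have e2 : R * (a / R) = a := by field_simp
  simp only [e1, e1', e2] at key
  rw [clusterFlux_rescale' hR.ne' hR2.le, clusterFlux_rescale' hR.ne' hR2.le, e2, ← mul_sub, abs_mul,
    abs_of_pos (div_pos hR2 hR), ← sub_div, abs_div, abs_of_pos hR2] at key
  have hR3 : 0 < R ^ 3 := by positivity
  have hq : R ^ 2 / R = R := by rw [pow_two, mul_div_assoc, div_self hR.ne', mul_one]
  rw [hq] at key
  -- `key : R * |ΔF| ≤ κ * (a/R)² * (|Δt| / R²)`; use `(a/R)² ≤ 1`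
  have hsq : (a / R) ^ 2 ≤ 1 := by nlinarith [ha'.1, ha'.2]
  rw [div_mul_eq_mul_div, le_div_iff₀ hR3]
  calc |clusterFlux (T t) a (𝒞 t a) - clusterFlux (T t') a (𝒞 t' a)| * R ^ 3
      = R ^ 2 * (R * |clusterFlux (T t) a (𝒞 t a) - clusterFlux (T t') a (𝒞 t' a)|) := by ring
    _ ≤ R ^ 2 * (κ * (a / R) ^ 2 * (|t - t'| / R ^ 2)) := mul_le_mul_of_nonneg_left key hR2.le
    _ = κ * (a / R) ^ 2 * |t - t'| := by field_simp
    _ ≤ κ * 1 * |t - t'| := by gcongr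
    _ = κ * |t - t'| := by ring

end Summit.NavierStokesRegularity.NavierStokesRegularity.Theorems.PoloidalLiouville.CellFlux

end
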